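import Mathlib
import Summits.CriticalPhenomena.Ising3DConformalLimit.Theorems.MarkovRigidityFieldRealisationSmearedLimit
import Summits.CriticalPhenomena.Ising3DConformalLimit.Theorems.MarkovRigidityFieldRealisationLatticeField
import HarnessLib

/-!
# Route MarkovRigidity, support item `FieldRealisation` (stmt-CriticalPhenomena-11245):
# moments and characteristic functions of the smeared critical field converge

Helper towards clause (b) of `FieldRealisation`.  For the approximating laws
`P_δ = spinFieldLaw ν (box 3 (L δ)) δ (ρ δ)` (`ν` carrying the critical plus correlations,
`δ L(δ) → ∞`) and a pointwise scaling limit `S` of `criticalCorr 3` under `ρ` (non-degenerate, scale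
covariant with `0 < Δ < 3/2`):

* `tendsto_moment_spinFieldLaw` — `E_{P_δ}[∏ᵢ ω(fᵢ)] → mₙ(f) := ∫ (∏ᵢ fᵢ(xᵢ)) Sₙ(x) dx`
  (`moment_spinFieldLaw_eq_sum` and `tendsto_smearedSum`; Schwartz decay `|f(p)| ≤ B(1+‖p‖)^{-4}`);
* `eventually_even_moment_le` — a UNIFORM Gaussian bound `E_{P_δ}[ω(f)^{2k}] ≤ (2k)!/(2ᵏk!) Wᵏ`
  for small `δ` (`W = 1 + ∫ |f|⊗|f| S₂`, Newman's inequality smeared, `moment_spinFieldLaw_even_le`);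
* `integral_exp_I_mul_eq_tsum` — the characteristic function of a bounded real random variable is
  its moment series `Σ iⁿ E[Xⁿ]/n!`;
* `tendsto_genFunctional_spinFieldLaw` — hence `S_{P_δ}(f) → C(f) := Σₙ iⁿ mₙ(f,…,f)/n!`
  (Tannery's theorem; the odd moments vanish).

References: Glimm–Jaffe 1987 §6.1; Newman 1975; Billingsley 1999.  No definitions.
-/

noncomputable section

namespace Summit.CriticalPhenomena.Ising3DConformalLimit.MarkovRigidityFieldRealisation

open MeasureTheory Filter Complex Literature.Probability.LatticeModels
  Literature.MathematicalPhysics.QuantumLattice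
open Summit.CriticalPhenomena.Ising3DConformalLimit
open scoped Topology Nat ENNReal

variable {ρ : ℝ → ℝ} {Δ : ℝ} {S : CorrFamily 3}
variable {ν : Measure (SpinConfig (Site 3))} [IsProbabilityMeasure ν]
variable {L : ℝ → ℕ}

/-! ### Schwartz decay -/

/-- A Schwartz function on `ℝ³` decays like `(1+‖p‖)^{-4}` with an explicit seminorm constant:
`|f(p)| ≤ 2⁴ (Σ_{m ≤ (4,0)} ‖f‖_m) (1+‖p‖)^{-4}`. [folklore] -/
theorem abs_le_seminorm_mul_weight (f : SchwartzMap (EuclideanSpace ℝ (Fin 3)) ℝ)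
    (p : EuclideanSpace ℝ (Fin 3)) :
    |f p| ≤ (2 ^ 4 * ((Finset.Iic ((4, 0) : ℕ × ℕ)).sup
      (schwartzSeminormFamily ℝ (EuclideanSpace ℝ (Fin 3)) ℝ)) f) * (1 + ‖p‖) ^ (-(4 : ℝ)) := by
  have h := SchwartzMap.one_add_le_sup_seminorm_apply (𝕜 := ℝ) (m := ((4, 0) : ℕ × ℕ)) (k := 4)
    (n := 0) le_rfl le_rfl f p
  rw [norm_iteratedFDeriv_zero, Real.norm_eq_abs] at h
  have hpos : 0 < (1 + ‖p‖) ^ 4 := by positivity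
  rw [Real.rpow_neg (by positivity), show (4 : ℝ) = ((4 : ℕ) : ℝ) by norm_num, Real.rpow_natCast,
    ← div_eq_mul_inv, le_div_iff₀ hpos, mul_comm]
  exact h

/-! ### Moments converge -/

/-- **Convergence of the moments of the smeared critical field**:
`E_{P_δ}[∏ᵢ ω(fᵢ)] → ∫ (∏ᵢ fᵢ(xᵢ)) Sₙ(x) dx` as `δ → 0⁺`. [cite: GlimmJaffe1987, §6.1] -/
theorem tendsto_moment_spinFieldLaw (hlim : HasPointwiseScalingLimit (criticalCorr 3) ρ S)
    (hnd : IsNondegenerateTwoPoint S) (hsc : IsScaleCovariant Δ S) (hΔ0 : 0 < Δ) (hΔ : Δ < 3 / 2)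
    (hν : ∀ A : Finset (Site 3), spinCorr ν A = plusCorr 3 (criticalBeta 3) 0 A)
    (hL : Tendsto (fun δ => δ * L δ) (𝓝[>] 0) atTop) {n : ℕ}
    (f : Fin n → SchwartzMap (EuclideanSpace ℝ (Fin 3)) ℝ) :
    Tendsto (fun δ => moment (spinFieldLaw ν (box 3 (L δ)) δ (ρ δ)) n f) (𝓝[>] 0)
      (𝓝 (∫ x : Fin n → EuclideanSpace ℝ (Fin 3), (∏ i, f i (x i)) * S n x)) := by
  simp_rw [moment_spinFieldLaw_eq_sum hν]
  set B : ℝ := ∑ i, (2 ^ 4 * ((Finset.Iic ((4, 0) : ℕ × ℕ)).sup (schwartzSeminormFamily ℝ (EuclideanSpace ℝ (Fin 3)) ℝ)) (f i)) with hB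
  refine tendsto_smearedSum hlim hnd hsc hΔ0 hΔ hL (fun i => ⇑(f i)) (fun i => (f i).continuous)
    (N := 4) (B := B) (by norm_num) fun i p => ?_
  refine (abs_le_seminorm_mul_weight (f i) p).trans (mul_le_mul_of_nonneg_right ?_ (weight_nonneg _ p))
  rw [hB]
  exact Finset.single_le_sum (f := fun i => 2 ^ 4 * ((Finset.Iic ((4, 0) : ℕ × ℕ)).sup (schwartzSeminormFamily ℝ (EuclideanSpace ℝ (Fin 3)) ℝ)) (f i)) (fun j _ => by positivity) (Finset.mem_univ i)

/-! ### The uniform Gaussian bound -/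

/-- **Convergence of smeared absolute two-point sums for two test functions**:
`Σ_{x,y∈Λ_δ} |a_x||b_y| ⟨σ_xσ_y⟩_{β_c} → ∫ |f(x₀)||h(x₁)| S₂(x) dx`. [cite: GlimmJaffe1987, §6.1] -/
theorem tendsto_absTwoPointSum₂ (hlim : HasPointwiseScalingLimit (criticalCorr 3) ρ S)
    (hnd : IsNondegenerateTwoPoint S) (hsc : IsScaleCovariant Δ S) (hΔ0 : 0 < Δ) (hΔ : Δ < 3 / 2)
    (hL : Tendsto (fun δ => δ * L δ) (𝓝[>] 0) atTop)
    (f h : SchwartzMap (EuclideanSpace ℝ (Fin 3)) ℝ) :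
    Tendsto (fun δ => ∑ x ∈ box 3 (L δ), ∑ y ∈ box 3 (L δ),
        |ρ δ * δ ^ 3 * f (δ • siteToE x)| * |ρ δ * δ ^ 3 * h (δ • siteToE y)| *
          criticalCorr 3 2 ![x, y]) (𝓝[>] 0)
      (𝓝 (∫ x : Fin 2 → EuclideanSpace ℝ (Fin 3), (|f (x 0)| * |h (x 1)|) * S 2 x)) := by
  set gs : Fin 2 → EuclideanSpace ℝ (Fin 3) → ℝ := ![fun p => |f p|, fun p => |h p|] with hgs
  have hg0 : gs 0 = fun p => |f p| := rfl
  have hg1 : gs 1 = fun p => |h p| := rfl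
  set B : ℝ := (2 ^ 4 * ((Finset.Iic ((4, 0) : ℕ × ℕ)).sup (schwartzSeminormFamily ℝ (EuclideanSpace ℝ (Fin 3)) ℝ)) f) +
    (2 ^ 4 * ((Finset.Iic ((4, 0) : ℕ × ℕ)).sup (schwartzSeminormFamily ℝ (EuclideanSpace ℝ (Fin 3)) ℝ)) h) with hB
  have hcont : ∀ i, Continuous (gs i) :=
    Fin.forall_fin_two.mpr ⟨hg0 ▸ f.continuous.abs, hg1 ▸ h.continuous.abs⟩
  have hsf : (0 : ℝ) ≤ 2 ^ 4 * ((Finset.Iic ((4, 0) : ℕ × ℕ)).sup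
      (schwartzSeminormFamily ℝ (EuclideanSpace ℝ (Fin 3)) ℝ)) f := by positivity
  have hsh : (0 : ℝ) ≤ 2 ^ 4 * ((Finset.Iic ((4, 0) : ℕ × ℕ)).sup
      (schwartzSeminormFamily ℝ (EuclideanSpace ℝ (Fin 3)) ℝ)) h := by positivity
  have hdec : ∀ i p, |gs i p| ≤ B * (1 + ‖p‖) ^ (-(4 : ℝ)) := by
    refine Fin.forall_fin_two.mpr ⟨fun p => ?_, fun p => ?_⟩
    · simp only [hg0, abs_abs]
      refine (abs_le_seminorm_mul_weight f p).trans
        (mul_le_mul_of_nonneg_right ?_ (weight_nonneg 4 p))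
      rw [hB]; linarith
    · simp only [hg1, abs_abs]
      refine (abs_le_seminorm_mul_weight h p).trans
        (mul_le_mul_of_nonneg_right ?_ (weight_nonneg 4 p))
      rw [hB]; linarith
  have hT := tendsto_smearedSum hlim hnd hsc hΔ0 hΔ hL (n := 2) gs hcont (N := 4) (B := B)
    (by norm_num) hdec
  have hlim' : (∫ x : Fin 2 → EuclideanSpace ℝ (Fin 3), (∏ i, gs i (x i)) * S 2 x) =
      ∫ x : Fin 2 → EuclideanSpace ℝ (Fin 3), (|f (x 0)| * |h (x 1)|) * S 2 x := by
    congr 1; funext x; simp [Fin.prod_univ_two, hg0, hg1]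
  rw [hlim'] at hT
  have hpos : ∀ᶠ δ in 𝓝[>] (0 : ℝ), 0 < δ := eventually_mem_nhdsWithin
  refine hT.congr' (hpos.mono fun δ hδ => ?_)
  rw [sum_piFinset_fin_two]
  refine Finset.sum_congr rfl fun x _ => Finset.sum_congr rfl fun y _ => ?_
  simp only [Fin.prod_univ_two, Matrix.cons_val_zero, Matrix.cons_val_one, hg0, hg1]
  rw [abs_mul (ρ δ * δ ^ 3), abs_mul (ρ δ * δ ^ 3)]
  have key : ρ δ * δ ^ 3 * (ρ δ * δ ^ 3) = |ρ δ * δ ^ 3| * |ρ δ * δ ^ 3| := (abs_mul_abs_self _).symm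
  calc ρ δ * δ ^ 3 * |f (δ • siteToE x)| * (ρ δ * δ ^ 3 * |h (δ • siteToE y)|) * criticalCorr 3 2 ![x, y]
      = ρ δ * δ ^ 3 * (ρ δ * δ ^ 3) * (|f (δ • siteToE x)| * |h (δ • siteToE y)|) *
          criticalCorr 3 2 ![x, y] := by ring
    _ = _ := by rw [key]; ring

/-- **Convergence of the smeared absolute two-point sums** (one test function):
`Σ_{a,b∈Λ_δ} |c_a||c_b| ⟨σ_aσ_b⟩_{β_c} → ∫ |f|⊗|f| S₂`, `c_x = ρ(δ) δ³ f(δx)`. [cite: GlimmJaffe1987, §6.1] -/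
theorem tendsto_absTwoPointSum (hlim : HasPointwiseScalingLimit (criticalCorr 3) ρ S)
    (hnd : IsNondegenerateTwoPoint S) (hsc : IsScaleCovariant Δ S) (hΔ0 : 0 < Δ) (hΔ : Δ < 3 / 2)
    (hL : Tendsto (fun δ => δ * L δ) (𝓝[>] 0) atTop)
    (f : SchwartzMap (EuclideanSpace ℝ (Fin 3)) ℝ) :
    Tendsto (fun δ => ∑ a ∈ box 3 (L δ), ∑ b ∈ box 3 (L δ),
        |ρ δ * δ ^ 3 * f (δ • siteToE a)| * |ρ δ * δ ^ 3 * f (δ • siteToE b)| *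
          criticalCorr 3 2 ![a, b]) (𝓝[>] 0)
      (𝓝 (∫ x : Fin 2 → EuclideanSpace ℝ (Fin 3), (∏ i, |f (x i)|) * S 2 x)) := by
  have h := tendsto_absTwoPointSum₂ hlim hnd hsc hΔ0 hΔ hL f f
  have e : (∫ x : Fin 2 → EuclideanSpace ℝ (Fin 3), (|f (x 0)| * |f (x 1)|) * S 2 x) =
      ∫ x : Fin 2 → EuclideanSpace ℝ (Fin 3), (∏ i, |f (x i)|) * S 2 x := by
    congr 1; funext x; simp [Fin.prod_univ_two]
  rw [e] at h
  exact h

/-- **Uniform Gaussian bound on the even moments** of `ω(f)` under `P_δ` for small `δ`: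
`E_{P_δ}[ω(f)^{2k}] ≤ (2k)!/(2ᵏk!) Wᵏ` with `W = 1 + ∫ |f|⊗|f| S₂`, for all `k` simultaneously.
[cite: AizenmanDuminilCopinAnnals2021, arXiv:1912.07973 §6.3, first display (p. 26)] -/
theorem eventually_even_moment_le (hlim : HasPointwiseScalingLimit (criticalCorr 3) ρ S)
    (hnd : IsNondegenerateTwoPoint S) (hsc : IsScaleCovariant Δ S) (hΔ0 : 0 < Δ) (hΔ : Δ < 3 / 2)
    (hν : ∀ A : Finset (Site 3), spinCorr ν A = plusCorr 3 (criticalBeta 3) 0 A)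
    (hL : Tendsto (fun δ => δ * L δ) (𝓝[>] 0) atTop)
    (f : SchwartzMap (EuclideanSpace ℝ (Fin 3)) ℝ) :
    ∀ᶠ δ in 𝓝[>] (0 : ℝ), ∀ k : ℕ,
      0 ≤ ∫ ω, (ω f) ^ (2 * k) ∂(spinFieldLaw ν (box 3 (L δ)) δ (ρ δ)) ∧
      ∫ ω, (ω f) ^ (2 * k) ∂(spinFieldLaw ν (box 3 (L δ)) δ (ρ δ)) ≤
        ((2 * k)! : ℝ) / (2 ^ k * k !) *
          (1 + ∫ x : Fin 2 → EuclideanSpace ℝ (Fin 3), (∏ i, |f (x i)|) * S 2 x) ^ k := by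
  set V : ℝ := ∫ x : Fin 2 → EuclideanSpace ℝ (Fin 3), (∏ i, |f (x i)|) * S 2 x with hV
  have hT := tendsto_absTwoPointSum hlim hnd hsc hΔ0 hΔ hL f
  have hVnn : 0 ≤ V := by
    refine ge_of_tendsto' hT fun δ => Finset.sum_nonneg fun a _ => Finset.sum_nonneg fun b _ =>
      mul_nonneg (mul_nonneg (abs_nonneg _) (abs_nonneg _))
        (RotationUpgradeFromTwoPointNegative.criticalCorr_nonneg _)
  filter_upwards [hT.eventually (gt_mem_nhds (by linarith : V < 1 + V))] with δ hδ k
  constructor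
  · exact integral_nonneg fun ω => by rw [pow_mul]; exact pow_nonneg (sq_nonneg _) _
  · rw [← moment_const_eq_integral_pow]
    refine (moment_spinFieldLaw_even_le hν (box 3 (L δ)) δ (ρ δ) k f).trans ?_
    refine mul_le_mul_of_nonneg_left (pow_le_pow_left₀ ?_ hδ.le k) (by positivity)
    exact Finset.sum_nonneg fun a _ => Finset.sum_nonneg fun b _ =>
      mul_nonneg (mul_nonneg (abs_nonneg _) (abs_nonneg _))
        (RotationUpgradeFromTwoPointNegative.criticalCorr_nonneg _)

/-- Odd moments of `ω(f)` under `P_δ` vanish. [cite: GlimmJaffe1987, §6.1] -/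
theorem integral_eval_pow_odd
    (hν : ∀ A : Finset (Site 3), spinCorr ν A = plusCorr 3 (criticalBeta 3) 0 A)
    (Λ : Finset (Site 3)) (δ r : ℝ) (k : ℕ) (f : SchwartzMap (EuclideanSpace ℝ (Fin 3)) ℝ) :
    ∫ ω, (ω f) ^ (2 * k + 1) ∂(spinFieldLaw ν Λ δ r) = 0 := by
  rw [← moment_const_eq_integral_pow]
  exact moment_spinFieldLaw_odd hν Λ δ r ⟨k, rfl⟩ _

/-! ### Characteristic functions of bounded random variables -/

/-- **The characteristic function of a bounded real random variable is its moment series**: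
`E[e^{iX}] = Σₙ iⁿ E[Xⁿ]/n!` when `|X| ≤ M`. [folklore] -/
theorem integral_exp_I_mul_eq_tsum {Ω : Type*} [MeasurableSpace Ω] (P : Measure Ω)
    [IsProbabilityMeasure P] {X : Ω → ℝ} (hX : Measurable X) {M : ℝ} (hM : ∀ ω, |X ω| ≤ M) :
    ∫ ω, exp (I * (X ω : ℂ)) ∂P = ∑' n : ℕ, I ^ n * ((∫ ω, X ω ^ n ∂P : ℝ) : ℂ) / n ! := by
  have hpt : ∀ ω, exp (I * (X ω : ℂ)) = ∑' n : ℕ, (I * (X ω : ℂ)) ^ n / n ! := by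
    intro ω
    rw [Complex.exp_eq_exp_ℂ]
    exact (NormedSpace.expSeries_div_hasSum_exp (I * (X ω : ℂ))).tsum_eq.symm
  simp_rw [hpt]
  rw [integral_tsum]
  · refine tsum_congr fun n => ?_
    have : ∀ ω, (I * (X ω : ℂ)) ^ n / n ! = (I ^ n / n !) * ((X ω ^ n : ℝ) : ℂ) := by
      intro ω; push_cast; ring
    simp_rw [this]
    rw [integral_const_mul]
    have hre : ∫ a, ((X a ^ n : ℝ) : ℂ) ∂P = ((∫ ω, X ω ^ n ∂P : ℝ) : ℂ) := integral_ofReal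
    rw [hre]
    ring
  · intro n
    exact ((((continuous_const.mul (continuous_ofReal.comp' continuous_id)).pow n).div_const _
      ).measurable.comp hX |>.aestronglyMeasurable)
  · have hle : ∀ n : ℕ, ∫⁻ ω, ‖(I * (X ω : ℂ)) ^ n / n !‖ₑ ∂P ≤ ENNReal.ofReal (|M| ^ n / n !) := by
      intro n
      calc ∫⁻ ω, ‖(I * (X ω : ℂ)) ^ n / n !‖ₑ ∂P ≤ ∫⁻ ω, ENNReal.ofReal (|M| ^ n / n !) ∂P := by
            refine lintegral_mono fun ω => ?_
            rw [← ofReal_norm]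
            refine ENNReal.ofReal_le_ofReal ?_
            rw [norm_div, norm_pow, norm_mul, Complex.norm_I, one_mul, Complex.norm_real,
              Real.norm_eq_abs, Complex.norm_natCast]
            exact div_le_div_of_nonneg_right
              (pow_le_pow_left₀ (abs_nonneg _) ((hM ω).trans (le_abs_self M)) n) (Nat.cast_nonneg _)
        _ = ENNReal.ofReal (|M| ^ n / n !) := by rw [lintegral_const, measure_univ, mul_one]
    have hsum : Summable fun n : ℕ => |M| ^ n / n ! := Real.summable_pow_div_factorial |M|
    refine ne_of_lt (lt_of_le_of_lt (ENNReal.tsum_le_tsum hle) ?_)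
    rw [← ENNReal.ofReal_tsum_of_nonneg (fun n => by positivity) hsum]
    exact ENNReal.ofReal_lt_top

/-- **Tannery's theorem for moment series**: if `a i n → m n` termwise, the odd terms vanish and the
even ones are Gaussian-dominated, `0 ≤ a i (2k) ≤ (2k)!/(2ᵏk!) Wᵏ`, eventually, then
`Σ iⁿ (a i n)/n! → Σ iⁿ (m n)/n!`. [folklore] -/
theorem tendsto_charSeries {ι : Type*} {l : Filter ι} (a : ι → ℕ → ℝ) (m : ℕ → ℝ) {W : ℝ}
    (hconv : ∀ n, Tendsto (fun i => a i n) l (𝓝 (m n)))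
    (hodd : ∀ᶠ i in l, ∀ k, a i (2 * k + 1) = 0)
    (heven : ∀ᶠ i in l, ∀ k, 0 ≤ a i (2 * k) ∧ a i (2 * k) ≤ ((2 * k)! : ℝ) / (2 ^ k * k !) * W ^ k) :
    Tendsto (fun i => ∑' n : ℕ, I ^ n * (a i n : ℂ) / n !) l
      (𝓝 (∑' n : ℕ, I ^ n * (m n : ℂ) / n !)) := by
  set bound : ℕ → ℝ := fun n => if Even n then (W / 2) ^ (n / 2) / (n / 2)! else 0 with hbound
  refine tendsto_tsum_of_dominated_convergence (bound := bound) ?_ (fun n => ?_) ?_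
  · refine Summable.even_add_odd ?_ ?_
    · have h : (fun k => bound (2 * k)) = fun k => (W / 2) ^ k / k ! := by
        funext k
        simp only [hbound, even_two_mul, if_true, Nat.mul_div_cancel_left k two_pos]
      rw [h]
      exact Real.summable_pow_div_factorial _
    · have h : (fun k => bound (2 * k + 1)) = fun _ => 0 := by
        funext k
        simp only [hbound, Nat.not_even_two_mul_add_one, if_false]
      rw [h]
      exact summable_zero
  · have hc : Continuous fun x : ℝ => I ^ n * (x : ℂ) / n ! :=
      (continuous_const.mul continuous_ofReal).div_const _
    exact (hc.tendsto _).comp (hconv n)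
  · filter_upwards [hodd, heven] with i ho he n
    rw [norm_div, norm_mul, norm_pow, Complex.norm_I, one_pow, one_mul, Complex.norm_real,
      Complex.norm_natCast, Real.norm_eq_abs]
    rcases Nat.even_or_odd n with ⟨k, rfl⟩ | ⟨k, rfl⟩
    · rw [← two_mul]
      simp only [hbound, even_two_mul, if_true, Nat.mul_div_cancel_left k two_pos]
      obtain ⟨h0, hle⟩ := he k
      rw [abs_of_nonneg h0, div_le_iff₀ (by positivity)]
      calc a i (2 * k) ≤ ((2 * k)! : ℝ) / (2 ^ k * k !) * W ^ k := hle
        _ = (W / 2) ^ k / k ! * (2 * k)! := by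
            rw [div_pow]; field_simp
    · simp only [hbound, Nat.not_even_two_mul_add_one, if_false]
      rw [ho k, abs_zero, zero_div]

/-! ### Characteristic functions converge -/

/-- **Convergence of the generating functionals of the smeared critical field**: for every test
function `f`, `S_{P_δ}(f) = E_{P_δ}[e^{iω(f)}] → C(f) := Σₙ iⁿ mₙ(f,…,f)/n!` as `δ → 0⁺`, where
`mₙ(f,…,f) = ∫ (∏ᵢ f(xᵢ)) Sₙ(x) dx` are the smeared limit correlations. [cite: GlimmJaffe1987, §6.1] -/
theorem tendsto_genFunctional_spinFieldLaw (hlim : HasPointwiseScalingLimit (criticalCorr 3) ρ S)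
    (hnd : IsNondegenerateTwoPoint S) (hsc : IsScaleCovariant Δ S) (hΔ0 : 0 < Δ) (hΔ : Δ < 3 / 2)
    (hν : ∀ A : Finset (Site 3), spinCorr ν A = plusCorr 3 (criticalBeta 3) 0 A)
    (hL : Tendsto (fun δ => δ * L δ) (𝓝[>] 0) atTop)
    (f : SchwartzMap (EuclideanSpace ℝ (Fin 3)) ℝ) :
    Tendsto (fun δ => genFunctional (spinFieldLaw ν (box 3 (L δ)) δ (ρ δ)) f) (𝓝[>] 0)
      (𝓝 (∑' n : ℕ, I ^ n *
        ((∫ x : Fin n → EuclideanSpace ℝ (Fin 3), (∏ i, f (x i)) * S n x : ℝ) : ℂ) / n !)) := by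
  -- the characteristic function as the moment series, for every `δ`
  have hseries : ∀ δ, genFunctional (spinFieldLaw ν (box 3 (L δ)) δ (ρ δ)) f =
      ∑' n : ℕ, I ^ n * ((∫ ω, (ω f) ^ n ∂(spinFieldLaw ν (box 3 (L δ)) δ (ρ δ)) : ℝ) : ℂ) / n ! := by
    intro δ
    rw [genFunctional_spinFieldLaw]
    have hX : Measurable fun σ => spinField (box 3 (L δ)) δ (ρ δ) σ f :=
      (measurable_eval f).comp (measurable_spinField _ δ (ρ δ))
    refine (integral_exp_I_mul_eq_tsum ν hX
      (fun σ => abs_spinField_apply_le (box 3 (L δ)) δ (ρ δ) σ f)).trans (tsum_congr fun n => ?_)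
    have hmap : ∫ ω, (ω f) ^ n ∂(spinFieldLaw ν (box 3 (L δ)) δ (ρ δ)) =
        ∫ σ, (spinField (box 3 (L δ)) δ (ρ δ) σ f) ^ n ∂ν := by
      unfold spinFieldLaw
      rw [integral_map (measurable_spinField _ δ (ρ δ)).aemeasurable
        ((measurable_eval f).pow_const n).aestronglyMeasurable]
    rw [hmap]
  simp_rw [hseries]
  refine tendsto_charSeries (fun δ n => ∫ ω, (ω f) ^ n ∂(spinFieldLaw ν (box 3 (L δ)) δ (ρ δ)))
    (fun n => ∫ x : Fin n → EuclideanSpace ℝ (Fin 3), (∏ i, f (x i)) * S n x)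
    (W := 1 + ∫ x : Fin 2 → EuclideanSpace ℝ (Fin 3), (∏ i, |f (x i)|) * S 2 x) (fun n => ?_)
    (Eventually.of_forall fun δ k => integral_eval_pow_odd hν _ δ (ρ δ) k f)
    (eventually_even_moment_le hlim hnd hsc hΔ0 hΔ hν hL f)
  have h := tendsto_moment_spinFieldLaw hlim hnd hsc hΔ0 hΔ hν hL (fun _ : Fin n => f)
  simp_rw [moment_const_eq_integral_pow] at h
  exact h

end Summit.CriticalPhenomena.Ising3DConformalLimit.MarkovRigidityFieldRealisation

end
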